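import Mathlib
import Summits.Ventures.HodgeRepro2.T6Interface
import Summits.Ventures.HodgeRepro2.Faces
import Summits.Ventures.HodgeRepro2.T6A1ProjData
import Summits.Ventures.HodgeRepro2.A1EigenlineDecompositionGalois
import Summits.Ventures.HodgeRepro2.BridgeTrace
import Summits.Ventures.HodgeRepro2.T6A1Main
import Summits.Ventures.HodgeRepro2.T6A2Model

/-!
# T6A1Complex — the complex side of A1 on the interface: eigenspaces, the complexified pull-back and the
Weil projector over `ℂ` (Theorem A1(i)–(iii) in `HBC K`)

Tier-6 sub-goal A1 (route/T6-A1-t6-p1.md §1 (A1.i)–(A1.iii); TARGET-T6.md §2 Layer II). On the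
interface's complex carrier `HBC K = ⋀_ℂ (Fin 4 → ℂ ⊗ K)`: the eigenspaces `V_σ = ⊕_i ℓ_{i,σ}`
(`eigenSpace`) span `H¹(B, ℂ)` (TIER4 (A0.4): `K ⊗ ℂ = ⊕_σ ℂ`, p7's `A1EigenlineDecompositionGalois`
at `L = ℂ`), the complexified pull-back `pullEndoC K x` of t6-p2's `T6A2Model` (imported, not re-typed:
`actH1C`, `pullEndoC`, `extC_pullEndo`, `extC_aeval`) acts on `V_σ` by `σ(x)`, so `⋀^4 H¹(B, ℂ)` carries the multigrading of `T6A1Monomials` with the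
eigenvalues `χ_k(x) = ∏_σ σ(x)^{k_σ}` — transported from the `F`-side of `T6A1WeilProjector` along an
embedding `τ : K → ℂ` (`chiC_eq`), so the SAME separating `x` and the SAME rational `Q` of a
`WeilProjData` give the complex projector `eC = Q([x]^*_ℂ)`: `eC (extC a) = extC (Q([x]^*) a)`
(`eC_extC`) and `eC` is `1` on the Weil pieces `k = 4e_σ` and `0` on the others (`eC_apply_of_mem_piece`).
-/

namespace Summit.Ventures.HodgeRepro2.T6.A1Complex

open Polynomial A1WeilProjector A1ProjData A1Monomials A2Model
open scoped TensorProduct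

variable (K : Type*) [Field K] [NumberField K]

/-! ## 1. The complexified pull-back on `H⁴(B, ℂ)` (t6-p2's `T6A2Model.pullEndoC` on the degree-4 part) -/

/-- `pullEndoC K x` on `H⁴(B, ℂ) = ⋀[ℂ]^4 (H1C K)` is `⋀⁴ (actH1C K x)`. -/
theorem pullEndoC_coe (x : K) (v : ⋀[ℂ]^4 (H1C K)) :
    pullEndoC K x (v : HBC K) = (exteriorPower.map 4 (actH1C K x) v : HBC K) := by
  have h : (pullEndoC K x).toLinearMap ∘ₗ (⋀[ℂ]^4 (H1C K)).subtype =
      (⋀[ℂ]^4 (H1C K)).subtype ∘ₗ exteriorPower.map 4 (actH1C K x) := by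
    apply exteriorPower.linearMap_ext
    ext w
    simp only [LinearMap.compAlternatingMap_apply, LinearMap.comp_apply, Submodule.subtype_apply,
      AlgHom.toLinearMap_apply, exteriorPower.map_apply_ιMulti, exteriorPower.ιMulti_apply_coe,
      ExteriorAlgebra.ιMulti_apply, map_list_prod, List.map_ofFn]
    congr 2
    funext i
    simp only [Function.comp_apply, pullEndoC_ι]
  exact LinearMap.congr_fun h v

/-! ## 2. The eigenspaces `V_σ = ⊕_i ℓ_{i,σ}` and their spanning (TIER4 (A0.4)) -/

/-- The `σ`-eigenspace `V_σ = ⊕_i ℓ_{i,σ} ⊆ H¹(B, ℂ)` (TIER4 (A0.6)). -/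
noncomputable def eigenSpace (σ : K →+* ℂ) : Submodule ℂ (H1C K) := ⨆ i, eigenLine K i σ

/-- `V_σ` is the set of vectors with every component in `eigenLineK K σ`. -/
theorem eigenSpace_eq_pi (σ : K →+* ℂ) :
    eigenSpace K σ = Submodule.pi Set.univ fun _ => eigenLineK K σ := by
  unfold eigenSpace eigenLine
  exact Submodule.iSup_map_single

/-- Membership in `V_σ`, componentwise. -/
theorem mem_eigenSpace (σ : K →+* ℂ) (v : H1C K) :
    v ∈ eigenSpace K σ ↔ ∀ i, v i ∈ eigenLineK K σ := by
  rw [eigenSpace_eq_pi, Submodule.mem_pi]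
  simp only [Set.mem_univ, true_implies]

/-- `x ⊗ 1` acts on `V_σ` by the scalar `σ(x)` (TIER4 (A0.6)). -/
theorem actH1C_apply_of_mem_eigenSpace (x : K) (σ : K →+* ℂ) {v : H1C K}
    (hv : v ∈ eigenSpace K σ) : actH1C K x v = σ x • v := by
  funext i
  rw [actH1C_apply, Pi.smul_apply]
  exact ((mem_eigenSpace K σ v).1 hv i) x

/-- The interface's `eigenLineK K σ` is p7's `eigenline ℂ K σ` (for `σ` read as a `ℚ`-algebra map). -/
theorem eigenLineK_eq (σ : K →+* ℂ) :
    eigenLineK K σ = A1EigenlinePermutation.eigenline ℂ K σ.toRatAlgHom := by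
  ext v
  rw [A1EigenlinePermutation.mem_eigenline_iff]
  have hact : ∀ x : K, A1EigenlinePermutation.actF ℂ x v =
      Algebra.TensorProduct.includeRight x * v := by
    intro x
    induction v using TensorProduct.induction_on with
    | zero => simp
    | tmul c y =>
      rw [A1EigenlinePermutation.actF_tmul, Algebra.TensorProduct.includeRight_apply,
        Algebra.TensorProduct.tmul_mul_tmul, one_mul, smul_eq_mul]
    | add v w hv hw => rw [map_add, hv, hw, mul_add]
  constructor
  · intro hv x
    rw [hact]
    exact hv x
  · intro hv x
    rw [← hact]
    exact hv x

/-- `K ⊗ ℂ = ⊕_σ ℂ`: the eigenlines of `KC K` span it (TIER4 (A0.4), p7's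
`A1EigenlineDecompositionGalois.isInternal_eigenline` at `L = ℂ`). -/
theorem iSup_eigenLineK_eq_top : ⨆ σ : K →+* ℂ, eigenLineK K σ = ⊤ := by
  classical
  have hcard : Fintype.card (K →ₐ[ℚ] ℂ) = Module.finrank ℚ K := AlgHom.card ℚ K ℂ
  have h := (A1EigenlineDecompositionGalois.isInternal_eigenline ℚ ℂ K K hcard).submodule_iSup_eq_top
  rw [eq_top_iff, ← h]
  refine iSup_le fun σ => ?_
  rw [← AlgHom.toRingHom_toRatAlgHom σ, ← eigenLineK_eq]
  exact le_iSup (fun ρ : K →+* ℂ => eigenLineK K ρ) (σ : K →+* ℂ)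

/-- The eigenspaces `V_σ` span `H¹(B, ℂ)`. -/
theorem iSup_eigenSpace_eq_top : ⨆ σ : K →+* ℂ, eigenSpace K σ = ⊤ := by
  classical
  rw [eq_top_iff, ← Submodule.pi_top (R := ℂ) (φ := fun _ : Fin 4 => KC K) Set.univ,
    ← Submodule.iSup_map_single]
  refine iSup_le fun i => ?_
  rw [← iSup_eigenLineK_eq_top, Submodule.map_iSup]
  refine iSup_le fun σ => ?_
  exact le_trans (le_iSup (fun i => eigenLine K i σ) i) (le_iSup (fun σ => eigenSpace K σ) σ)


/-! ## 3. Transport of the eigenvalues `χ_k(x)` and of `Q`'s values from `F` to `ℂ` (Lemmas A2.1–A2.2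
over `ℂ`) -/

section transport

variable [IsGalois ℚ K]

/-- A fixed embedding `τ : K → ℂ` (exists: p4's `BridgeTrace.nonempty_algHom_complex`). -/
noncomputable def τ : K →ₐ[ℚ] ℂ := Classical.choice BridgeTrace.nonempty_algHom_complex

/-- `σ ↦ τ ∘ σ`: the `ℚ`-algebra endomorphisms of `K` (= `Gal(K/ℚ)`) correspond to the embeddings
`K → ℂ` (p1's `galEmb`; `K/ℚ` Galois). -/
noncomputable def embEquiv : (K →ₐ[ℚ] K) ≃ (K →+* ℂ) :=
  Equiv.ofBijective (fun σ => (τ K).toRingHom.comp σ.toRingHom) (by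
    constructor
    · intro σ σ' h
      exact AlgHom.ext fun y => (τ K).injective (RingHom.congr_fun h y)
    · intro ρ
      obtain ⟨g, hg⟩ := (galEmb K (τ K).toRingHom).surjective ρ
      refine ⟨g.toAlgHom, ?_⟩
      rw [galEmb_apply] at hg
      exact hg)

/-- `embEquiv K σ = τ ∘ σ`. -/
theorem embEquiv_apply (σ : K →ₐ[ℚ] K) (y : K) : embEquiv K σ y = τ K (σ y) := rfl

/-- The eigenvalue `χ_k(x) = ∏_ρ ρ(x)^{k_ρ}` over `ℂ`, indexed by the embeddings `K → ℂ`. -/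
noncomputable def chiC (n : ℕ) (x : K) (k : (K →+* ℂ) → Fin (n + 1)) : ℂ := ∏ ρ, ρ x ^ (k ρ : ℕ)

/-- `χ_k(x)` over `ℂ` is the image under `τ` of `χ_{k ∘ e}(x)` over `F` (TIER4 Lemma A2.2(ii)'s
`F_1 = τ_1(F)`). -/
theorem chiC_eq (n : ℕ) (x : K) (k : (K →+* ℂ) → Fin (n + 1)) :
    chiC K n x k = τ K (chi K n x (k ∘ embEquiv K)) := by
  unfold chiC chi
  rw [map_prod]
  simp only [map_pow]
  exact (Fintype.prod_equiv (embEquiv K) (fun σ => τ K (σ x) ^ (k (embEquiv K σ) : ℕ))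
    (fun ρ => ρ x ^ (k ρ : ℕ)) fun _ => rfl).symm

/-- A separating `x` over `F` is separating over `ℂ` (Lemma A2.1 over `ℂ`). -/
theorem chiC_injective (n : ℕ) (x : K) (hx : Function.Injective (chi K n x)) :
    Function.Injective (chiC K n x) := by
  intro k k' h
  rw [chiC_eq, chiC_eq] at h
  have h' := hx ((τ K).injective h)
  funext ρ
  have := congrFun h' ((embEquiv K).symm ρ)
  simpa only [Function.comp_apply, Equiv.apply_symm_apply] using this

variable [DecidableEq (K →+* ℂ)] [DecidableEq (K →ₐ[ℚ] K)]

/-- The Weil multi-index `n·e_ρ` over `ℂ`. -/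
def weilIdxC (n : ℕ) (ρ : K →+* ℂ) : (K →+* ℂ) → Fin (n + 1) := Pi.single ρ (Fin.last n)

/-- Weil indices over `F` and over `ℂ` correspond under `embEquiv`. -/
theorem weilIdx_iff (n : ℕ) (k : (K →+* ℂ) → Fin (n + 1)) :
    (∃ σ, k ∘ embEquiv K = weilIdx K n σ) ↔ ∃ ρ, k = weilIdxC K n ρ := by
  constructor
  · rintro ⟨σ, hσ⟩
    refine ⟨embEquiv K σ, ?_⟩
    funext ρ
    have := congrFun hσ ((embEquiv K).symm ρ)
    simp only [Function.comp_apply, Equiv.apply_symm_apply, weilIdx, Pi.single_apply,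
      Equiv.symm_apply_eq] at this
    simpa only [weilIdxC, Pi.single_apply] using this
  · rintro ⟨ρ, hρ⟩
    refine ⟨(embEquiv K).symm ρ, ?_⟩
    funext σ
    simp only [Function.comp_apply, hρ, weilIdxC, weilIdx, Pi.single_apply, Equiv.eq_symm_apply]

/-- Lemma A2.2 over `ℂ`: the rational projector polynomial `Q` takes the value `1` at the Weil nodes
`χ_{n e_ρ}(x) = ρ(x)^n` and `0` at the other nodes `χ_k(x)`, `k` with entries `≤ n`. -/
theorem eval_map_chiC (n : ℕ) (x : K) (hx : Function.Injective (chi K n x)) [DecidableEq K]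
    (Q : ℚ[X]) (hQ : Q.map (algebraMap ℚ K) = lagrangeP K n x) (k : (K →+* ℂ) → Fin (n + 1)) :
    (Q.map (algebraMap ℚ ℂ)).eval (chiC K n x k) =
      if ∃ ρ, k = weilIdxC K n ρ then (1 : ℂ) else 0 := by
  rw [chiC_eq]
  have h1 : ∀ a : K, (Q.map (algebraMap ℚ ℂ)).eval (τ K a) =
      τ K ((Q.map (algebraMap ℚ K)).eval a) := by
    intro a
    rw [Polynomial.eval_map, Polynomial.eval_map]
    have := Polynomial.hom_eval₂ Q (algebraMap ℚ K) (τ K).toRingHom a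
    have h2 : (τ K).toRingHom.comp (algebraMap ℚ K) = algebraMap ℚ ℂ :=
      RingHom.ext fun q => (τ K).commutes q
    rw [h2] at this
    exact this.symm
  rw [h1, hQ, eval_lagrangeP K n x hx]
  by_cases h : ∃ ρ, k = weilIdxC K n ρ
  · rw [if_pos h, if_pos ((weilIdx_iff K n k).2 h), map_one]
  · rw [if_neg h, if_neg (fun h' => h ((weilIdx_iff K n k).1 h')), map_zero]

end transport

/-! ## 4. The complex eigen-data of `⋀⁴ H¹(B, ℂ)` and the complex Weil projector `e_ℂ = Q([x]^*_ℂ)` -/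

section projector

variable [IsGalois ℚ K] [DecidableEq (K →+* ℂ)] [DecidableEq (K →ₐ[ℚ] K)] [DecidableEq K]

omit [DecidableEq (K →ₐ[ℚ] K)] [DecidableEq K] in
/-- The multigrading of `⋀⁴ H¹(B, ℂ)` by the eigenspaces `V_σ`, as p4's `EigenData` for `⋀⁴(x ⊗ 1)`
(TIER4 (A0.6) over `ℂ`). -/
theorem eigenDataC (x : K) (hx : Function.Injective (chi K 4 x)) :
    BridgeProjector.EigenData (exteriorPower.map 4 (actH1C K x))
      (fun k : (K →+* ℂ) → Fin 5 => piece (eigenSpace K) 4 fun ρ => (k ρ : ℕ)) (chiC K 4 x) :=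
  A1Monomials.eigenData (eigenSpace K) (iSup_eigenSpace_eq_top K) (actH1C K x) (fun ρ => ρ x)
    (fun ρ _ hv => actH1C_apply_of_mem_eigenSpace K x ρ hv) 4 (chiC_injective K 4 x hx)

variable (P : WeilProjData K 4)

/-- The rational Weil projector `p_W = Q([x]^*)` on the whole of `H^*(B, ℚ)`. -/
noncomputable def pW : Module.End ℚ (HB K) := aeval (pullEndo K P.x).toLinearMap P.Q

/-- The complex Weil projector `e_ℂ = Q([x]^*_ℂ)` on `H^*(B, ℂ)`. -/
noncomputable def eC : Module.End ℂ (HBC K) :=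
  aeval (pullEndoC K P.x).toLinearMap (P.Q.map (algebraMap ℚ ℂ))

omit [IsGalois ℚ K] [DecidableEq (K →+* ℂ)] [DecidableEq (K →ₐ[ℚ] K)] [DecidableEq K] in
/-- Powers of `pullEndo K x` on `H⁴(B, ℚ)` are powers of `T`. -/
theorem pullEndo_pow_coe (x : K) (j : ℕ) (v : ⋀[ℚ]^4 (H1 K)) :
    ((pullEndo K x).toLinearMap ^ j) (v : HB K) = ((T K (H1 K) 4 x ^ j) v : HB K) := by
  induction j with
  | zero => rfl
  | succ j ih => rw [pow_succ', pow_succ', Module.End.mul_apply, Module.End.mul_apply, ih,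
      AlgHom.toLinearMap_apply, A1Main.pullEndo_coe_T]

omit [IsGalois ℚ K] [DecidableEq (K →+* ℂ)] in
/-- On `H⁴(B, ℚ)`, `p_W` is the projector `P.proj` of `T6A1ProjData`. -/
theorem pW_coe (v : ⋀[ℚ]^4 (H1 K)) : pW K P (v : HB K) = (P.proj (H1 K) v : HB K) := by
  unfold pW WeilProjData.proj
  rw [Polynomial.aeval_eq_sum_range, Polynomial.aeval_eq_sum_range, LinearMap.sum_apply,
    LinearMap.sum_apply, Submodule.coe_sum]
  refine Finset.sum_congr rfl fun j _ => ?_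
  rw [LinearMap.smul_apply, LinearMap.smul_apply, Submodule.coe_smul, pullEndo_pow_coe]

omit [IsGalois ℚ K] [DecidableEq (K →+* ℂ)] [DecidableEq (K →ₐ[ℚ] K)] [DecidableEq K] in
/-- Powers of `pullEndoC K x` on `H⁴(B, ℂ)` are powers of `⋀⁴ (actH1C K x)`. -/
theorem pullEndoC_pow_coe (x : K) (j : ℕ) (v : ⋀[ℂ]^4 (H1C K)) :
    ((pullEndoC K x).toLinearMap ^ j) (v : HBC K) =
      ((exteriorPower.map 4 (actH1C K x) ^ j) v : HBC K) := by
  induction j with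
  | zero => rfl
  | succ j ih => rw [pow_succ', pow_succ', Module.End.mul_apply, Module.End.mul_apply, ih,
      AlgHom.toLinearMap_apply, pullEndoC_coe]

omit [IsGalois ℚ K] [DecidableEq (K →+* ℂ)] in
/-- `extC` intertwines the rational and the complex Weil projectors:
`e_ℂ (a ⊗ 1) = (p_W a) ⊗ 1` (TIER4 Prop. A2.3(i): `p_W ⊗ ℂ`; t6-p2's `extC_aeval`). -/
theorem eC_extC (a : HB K) : eC K P (extC K a) = extC K (pW K P a) :=
  (extC_aeval K P.x P.Q a).symm

/-- `e_ℂ` acts on the piece `H^{(k)}` of `⋀⁴ H¹(B, ℂ)` as `1` if `k = 4e_ρ` is a Weil index and as `0`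
otherwise (TIER4 Prop. A2.3(i) over `ℂ`). -/
theorem eC_coe_of_mem_piece (k : (K →+* ℂ) → Fin 5) {v : ⋀[ℂ]^4 (H1C K)}
    (hv : v ∈ piece (eigenSpace K) 4 fun ρ => (k ρ : ℕ)) :
    eC K P (v : HBC K) = (if ∃ ρ, k = weilIdxC K 4 ρ then (1 : ℂ) else 0) • (v : HBC K) := by
  have h : eC K P (v : HBC K) =
      ((aeval (exteriorPower.map 4 (actH1C K P.x)) (P.Q.map (algebraMap ℚ ℂ))) v : HBC K) := by
    unfold eC
    rw [Polynomial.aeval_eq_sum_range, Polynomial.aeval_eq_sum_range, LinearMap.sum_apply,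
      LinearMap.sum_apply, Submodule.coe_sum]
    refine Finset.sum_congr rfl fun j _ => ?_
    rw [LinearMap.smul_apply, LinearMap.smul_apply, Submodule.coe_smul, pullEndoC_pow_coe]
  rw [h, (eigenDataC K P.x P.sep).aeval_apply_eq_smul k hv, eval_map_chiC K 4 P.x P.sep P.Q P.map_eq k,
    Submodule.coe_smul]

end projector

end Summit.Ventures.HodgeRepro2.T6.A1Complex
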